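import Summits.BirchSwinnertonDyer.BirchSwinnertonDyer.Theorems.Rank2ObservatoryRank3CensusResidual
import Summits.BirchSwinnertonDyer.BirchSwinnertonDyer.Theorems.Rank2ObservatoryRank3ConductorTotal
import HarnessLib

/-!
# BirchSwinnertonDyer — rank ≥ 2 observatory: rank-3 CENSUS AUDIT by CURVE — 9 365 pairwise distinct elliptic curves of rank exactly 3 (kernel)

HONEST FRAMING: per-curve certified theorems and census instruments; no claim on BSD in rank ≥ 2.

Fourth file of the RESIDUAL-EXACTNESS AUDIT of the GRAND rank-3 census `Rank3KernelRankCensusN9365` against the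
census table `rank3Table` (9 487 rows: Cremona label, `[a₁,a₂,a₃,a₄,a₆]`, conductor `N < 5·10⁵`, three points).  The
first three files (`Rank2ObservatoryRank3CensusAudit`, `…AuditCover`, `…Residual`) work at the level of TABLE ROWS
(`rank3Table.Nodup`, `rows ~ rank3Table.filter (· ∉ residualRows)`, `mem_rows_iff`).  This file passes to the
mathematical objects, the Weierstrass models `Rank3Row.curve r = ⟨a₁, a₂, a₃, a₄, a₆⟩ / ℚ`:
* `rank3Table_curve_injOn` : two table rows with the same Weierstrass model are the same row — from the kernel
  duplicate-freeness certificate of the integer keys `(N, a₁, …, a₆)` (`rank3Table_keys_ndCheck`, file 1) and the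
  kernel CONDUCTOR THEOREM `Rank3Row.conductorNorm_eq_of_mem : N_{E_r} = r.N` (`Rank2ObservatoryRank3ConductorTotal`),
  which makes the key a function of the curve;
* `rank3Table_curves_nodup` / `rows_curves_nodup` / `residualRows_curves_nodup` : the 9 487 table rows, the 9 365
  GRAND-census rows and the 122 residual rows are that many PAIRWISE DISTINCT CURVES;
* `mem_residualRows_iff_curve` / `mem_rows_iff_curve` / `rank_eq_three_of_curve_not_mem` : the residual register
  stated on curves — a table curve has its hypothesis-free rank theorem iff it is not one of the 122 residual curves;
* `conductorNorm_lt_of_mem` : every table curve has conductor `N_E < 500 000` (kernel: `N_E = N` and `N < 500 000`);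
* HEADLINES `exists_distinct_curves_rank_three` : there is a duplicate-free list of 9 365 elliptic curves over `ℚ` of
  conductor `< 500 000` each with `rank_ℤ E(ℚ) = 3`, proved with NO hypothesis; `exists_distinct_curves_rank_three_table` :
  the same for all 9 487 table curves when the 2-descent bound `rank_ℤ ≤ 3` is granted for the 122 residual curves only;
  `exists_distinct_curves_lvalues` : 9 487 distinct elliptic curves with `3 ≤ rank_ℤ` (kernel) and, given only
  Gross–Zagier–Kolyvagin, `L(E,1) = L′(E,1) = 0`.
Table completeness ("these are ALL rank-3 curves of conductor `< 5·10⁵`") is DATA from Cremona's tables and is not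
claimed.  Sorry-free; no new axioms; kernel `decide` only (no `native_decide`).
References: J. E. Cremona, *Algorithms for Modular Elliptic Curves* (2nd ed. 1997) Tables, §2.13, §3.5, §3.6;
J. W. S. Cassels, *Lectures on Elliptic Curves* (1991) §15; J. H. Silverman, *Advanced Topics in the Arithmetic of
Elliptic Curves* (1994) IV.10–IV.11; H. Darmon, *Rational Points on Modular Elliptic Curves* (2004) Thm. 3.22.
-/

-- single-conjunct summit: `Summit.BirchSwinnertonDyer.BirchSwinnertonDyer.…` repeats the name by design
set_option linter.dupNamespace false
-- deep literal lists behind the table definition: raise the recursion budget for the whole file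
set_option maxRecDepth 400000

namespace Summit.BirchSwinnertonDyer.BirchSwinnertonDyer.Rank2Observatory

open Literature Literature.NumberTheory.EllipticCurves WeierstrassCurve
open Rank3CensusAudit

/-- The a-invariants of a row are read off its Weierstrass model over `ℚ` (`Int.cast` is injective). [folklore] -/
theorem Rank3Row.ainv_eq_of_curve_eq {r s : Rank3Row} (h : r.curve = s.curve) :
    r.a₁ = s.a₁ ∧ r.a₂ = s.a₂ ∧ r.a₃ = s.a₃ ∧ r.a₄ = s.a₄ ∧ r.a₆ = s.a₆ := by
  simp only [Rank3Row.curve, WeierstrassCurve.mk.injEq, Int.cast_inj] at h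
  exact h

/-- Kernel check: every conductor of the census table is `< 500 000`. [cite: CremonaAlgorithms1997, Tables] -/
theorem rank3Table_all_N_lt : (rank3Table.all fun r => decide (r.N < 500000)) = true := by
  decide +kernel

/-- Every row of the census table has `N < 500 000`. [cite: CremonaAlgorithms1997, Tables] -/
theorem N_lt_of_mem {r : Rank3Row} (hr : r ∈ rank3Table) : r.N < 500000 :=
  of_decide_eq_true (List.all_eq_true.1 rank3Table_all_N_lt r hr)

/-- **Every curve of the census table has conductor `N_E < 500 000`** (kernel: the conductor theorem `N_E = N` of
`Rank2ObservatoryRank3ConductorTotal` and `N < 500 000`). [cite: Silverman1994, IV.10.2 and IV.11.1]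
[cite: CremonaAlgorithms1997, Tables] -/
theorem Rank3Row.conductorNorm_lt_of_mem {r : Rank3Row} (hr : r ∈ rank3Table) :
    r.curve.conductorNorm ℤ < 500000 := by
  rw [Rank3Row.conductorNorm_eq_of_mem hr]
  exact N_lt_of_mem hr

/-- **The census table lists each curve once**: two rows with the same Weierstrass model are equal.  The integer keys
`(N, a₁, a₂, a₃, a₄, a₆)` are pairwise distinct along the table (kernel certificate `rank3Table_keys_ndCheck`) and the
key is a function of the curve because `N = N_E` is a THEOREM for every row. [cite: CremonaAlgorithms1997, Tables]
[cite: Silverman1994, IV.10.2 and IV.11.1] -/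
theorem rank3Table_curve_injOn : ∀ r ∈ rank3Table, ∀ s ∈ rank3Table, r.curve = s.curve → r = s := by
  intro r hr s hs h
  have h₁ := Rank3Row.conductorNorm_eq_of_mem hr
  have h₂ := Rank3Row.conductorNorm_eq_of_mem hs
  rw [h] at h₁
  have hN : r.N = s.N := h₁.symm.trans h₂
  obtain ⟨e₁, e₂, e₃, e₄, e₆⟩ := Rank3Row.ainv_eq_of_curve_eq h
  refine List.inj_on_of_nodup_map (CensusAudit.nodup_of_ndCheck rank3Table_keys_ndCheck) hr hs ?_
  simp only [hN, e₁, e₂, e₃, e₄, e₆]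

/-- **The 9 487 rows of the census table are 9 487 pairwise distinct curves.** [cite: CremonaAlgorithms1997, Tables] -/
theorem rank3Table_curves_nodup : (rank3Table.map Rank3Row.curve).Nodup :=
  List.Nodup.map_on rank3Table_curve_injOn rank3Table_nodup

/-- **The 9 365 rows of the GRAND census are 9 365 pairwise distinct curves.** [cite: CremonaAlgorithms1997, Tables] -/
theorem rows_curves_nodup : (Rank3KernelRankCensusN9365.rows.map Rank3Row.curve).Nodup :=
  List.Nodup.map_on (fun r hr s hs h => rank3Table_curve_injOn r (mem_rows_iff.1 hr).1 s (mem_rows_iff.1 hs).1 h)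
    rows_nodup

/-- The 122 residual rows are 122 pairwise distinct curves. [cite: CremonaAlgorithms1997, Tables] -/
theorem residualRows_curves_nodup : (residualRows.map Rank3Row.curve).Nodup :=
  List.Nodup.map_on (fun r hr s hs h => rank3Table_curve_injOn r (residualRows_subset r hr) s (residualRows_subset s hs) h)
    residualRows_nodup

/-- **The residual register, on curves**: a table row is residual iff its CURVE is one of the 122 residual curves.
[cite: CremonaAlgorithms1997, Tables] -/
theorem mem_residualRows_iff_curve {r : Rank3Row} (hr : r ∈ rank3Table) :
    r ∈ residualRows ↔ r.curve ∈ residualRows.map Rank3Row.curve := by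
  constructor
  · exact fun h => List.mem_map.2 ⟨r, h, rfl⟩
  · intro h
    obtain ⟨s, hs, hcs⟩ := List.mem_map.1 h
    rwa [rank3Table_curve_injOn r hr s (residualRows_subset s hs) hcs.symm]

/-- A table row is a GRAND-census row iff its curve is not one of the 122 residual curves. [cite: CremonaAlgorithms1997, Tables] -/
theorem mem_rows_iff_curve {r : Rank3Row} (hr : r ∈ rank3Table) :
    r ∈ Rank3KernelRankCensusN9365.rows ↔ r.curve ∉ residualRows.map Rank3Row.curve := by
  rw [mem_rows_iff, ← mem_residualRows_iff_curve hr]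
  exact ⟨fun h => h.2, fun h => ⟨hr, h⟩⟩

/-- **`rank_ℤ(E_r(ℚ)) = 3` with NO hypothesis for every table row whose curve is not one of the 122 residual curves.**
[cite: Cassels1991LecturesEllipticCurves, §15] [cite: CremonaAlgorithms1997, §3.5, §3.6] -/
theorem rank_eq_three_of_curve_not_mem {r : Rank3Row} (hr : r ∈ rank3Table)
    (h : r.curve ∉ residualRows.map Rank3Row.curve) : r.curve.mordellWeilRank = 3 :=
  rank_eq_three_of_not_mem_residualRows hr fun hres => h ((mem_residualRows_iff_curve hr).1 hres)

/-- Curve form: a Weierstrass model listed in the census table and not among the 122 residual curves has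
`rank_ℤ E(ℚ) = 3`, NO hypothesis. [cite: Cassels1991LecturesEllipticCurves, §15] [cite: CremonaAlgorithms1997, §3.5, §3.6] -/
theorem rank_eq_three_of_mem_curves {E : WeierstrassCurve ℚ} (hE : E ∈ rank3Table.map Rank3Row.curve)
    (hn : E ∉ residualRows.map Rank3Row.curve) : E.mordellWeilRank = 3 := by
  obtain ⟨r, hr, rfl⟩ := List.mem_map.1 hE
  exact rank_eq_three_of_curve_not_mem hr hn

/-- **HEADLINE.** There is a duplicate-free list of **9 365 elliptic curves over `ℚ` of conductor `< 500 000`, each with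
Mordell–Weil rank EXACTLY 3**, proved with NO hypothesis (kernel-checked 2-descent / isogeny-descent upper bounds and
three independent points per curve; the list is `Rank3KernelRankCensusN9365.rows.map Rank3Row.curve`).
[cite: Cassels1991LecturesEllipticCurves, §15] [cite: CremonaAlgorithms1997, Tables, §3.5, §3.6] -/
theorem exists_distinct_curves_rank_three :
    ∃ l : List (WeierstrassCurve ℚ), l.Nodup ∧ l.length = 9365 ∧
      ∀ E ∈ l, E.IsElliptic ∧ E.conductorNorm ℤ < 500000 ∧ E.mordellWeilRank = 3 := by
  refine ⟨Rank3KernelRankCensusN9365.rows.map Rank3Row.curve, rows_curves_nodup,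
    by rw [List.length_map, Rank3KernelRankCensusN9365.rows_length], ?_⟩
  intro E hE
  obtain ⟨r, hr, rfl⟩ := List.mem_map.1 hE
  have hrt : r ∈ rank3Table := (mem_rows_iff.1 hr).1
  exact ⟨isElliptic_of_mem hrt, Rank3Row.conductorNorm_lt_of_mem hrt, Rank3KernelRankCensusN9365.rank_eq_three r hr⟩

/-- **HEADLINE, whole table.** Granting the 2-descent bound `rank_ℤ ≤ 3` for the 122 residual curves ONLY, the 9 487
curves of the census table are 9 487 pairwise distinct elliptic curves of conductor `< 500 000` with `rank_ℤ E(ℚ) = 3`.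
[cite: Cassels1991LecturesEllipticCurves, §15] [cite: CremonaAlgorithms1997, Tables, §3.5, §3.6] -/
theorem exists_distinct_curves_rank_three_table (hup : ∀ r ∈ residualRows, r.curve.mordellWeilRank ≤ 3) :
    ∃ l : List (WeierstrassCurve ℚ), l.Nodup ∧ l.length = 9487 ∧
      ∀ E ∈ l, E.IsElliptic ∧ E.conductorNorm ℤ < 500000 ∧ E.mordellWeilRank = 3 := by
  refine ⟨rank3Table.map Rank3Row.curve, rank3Table_curves_nodup, by rw [List.length_map, rank3Table_length], ?_⟩
  intro E hE
  obtain ⟨r, hr, rfl⟩ := List.mem_map.1 hE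
  exact ⟨isElliptic_of_mem hr, Rank3Row.conductorNorm_lt_of_mem hr, rank_eq_three_of_mem_rank3Table hr (hup r)⟩

/-- **HEADLINE, analytic side.** The 9 487 curves of the census table are pairwise distinct elliptic curves of conductor
`< 500 000` with `3 ≤ rank_ℤ E(ℚ)` (kernel: three independent points) and hence, given ONLY Gross–Zagier–Kolyvagin
(`hGZK`, bsd.S17), `L(E,1) = 0` and `L′(E,1) = 0` exactly. [cite: CremonaAlgorithms1997, §2.13, §3.5] [cite: Darmon2004, Thm. 3.22] -/
theorem exists_distinct_curves_lvalues (hGZK : rank_eq_analyticRank_of_analyticRank_le_one) :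
    ∃ l : List (WeierstrassCurve ℚ), l.Nodup ∧ l.length = 9487 ∧
      ∀ E ∈ l, E.IsElliptic ∧ E.conductorNorm ℤ < 500000 ∧ 3 ≤ E.mordellWeilRank ∧
        E.entireLFunction 1 = 0 ∧ deriv E.entireLFunction 1 = 0 := by
  refine ⟨rank3Table.map Rank3Row.curve, rank3Table_curves_nodup, by rw [List.length_map, rank3Table_length], ?_⟩
  intro E hE
  obtain ⟨r, hr, rfl⟩ := List.mem_map.1 hE
  exact ⟨isElliptic_of_mem hr, Rank3Row.conductorNorm_lt_of_mem hr, three_le_mordellWeilRank_of_mem_rank3Table r hr,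
    Rank3Row.lvalues_eq_zero_kernel hr hGZK⟩

end Summit.BirchSwinnertonDyer.BirchSwinnertonDyer.Rank2Observatory
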